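import Summits.FinalStateConjecture.FinalStateConjecture.Theorems.EIHFluxBalanceInertialRecessionStubSlaving12RelRicciC3
import Summits.FinalStateConjecture.FinalStateConjecture.Theorems.EIHFluxBalanceInertialRecessionStubRechart3OwnTerm

/-!
# Route EIHFluxBalance — `InertialRecession` (E′), line `SketchCleanExcision`, skeleton r13,
# stub `stub_momCapstone` (A): JET-FREE bounds for the SLICE DATA of the frozen ansatz

Helper file for the crux `stmt-FinalStateConjecture-17403`
(`Summit.FinalStateConjecture.FinalStateConjecture.Theses.EIHFluxBalance.InertialRecession`, E′),
registered stub `stub_momCapstone` (A) of skeleton r13. The momentum-row estimate of the stub is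
LINEAR in the first jet of the painted motion because the slice data of the modulated ansatz
`g₀ = η + Σⱼ (g_{Mⱼ,aⱼ} ∘ Λⱼ(x⁰)⁻¹(· − cⱼ(x⁰)) − η)` at `x` — its spatial first derivatives
`Dg₀(x) ∘ π` and spatial–spatial second derivatives `D²g₀(x)(π·, π·)`, `π v = v − v⁰ e₀` — do not
see the motion of the moduli at all: they are the corresponding derivatives of the field FROZEN at
the lab time `x⁰`, a finite sum of boosted, translated Kerr–Schild fields with constant labels.

* `momCap_hasFDerivAt_comp_affine`, `momCap_jets_comp_affine` — chain rule, to second order, for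
  `z ↦ Φ(K(A(z − c)))` (`Φ` a fixed continuous linear map, `A` linear): the derivatives at `y` are
  bounded by `‖Φ‖ ‖DK‖ ‖A‖` and `‖Φ‖ ‖D²K‖ ‖A‖²` at `A(y − c)`;
* `momCap_frozen_summand_bounds` — for ONE frozen summand `boostedKerrBilin L c M a`:
  `‖D(·)(y)‖ ≤ C‖Λ⁻¹‖³`, `‖D²(·)(y)‖ ≤ C‖Λ⁻¹‖⁴` whenever `r(Λ⁻¹(y − c)) ≥ r₀ > 0`, with `C = C(M, a, r₀)`
  (the uniform `C²` bound of `g_{M,a}` on `{r ≥ r₀}`, `exists_bound_iteratedFDeriv_kerr`);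
* `momCap_fderiv_apply_eq_of_slice` — spatial derivatives of two functions agreeing on the slice
  `{z⁰ = y⁰}` NEAR `y` coincide (local form of `fderiv_apply_eq_of_eqOn_slice`);
* `momCap_sliceData_bound` — **the slice data of the modulated ansatz are bounded, uniformly in the
  motion**: `‖Dg₀(x) ∘ π‖, ‖D²g₀(x)(π·, π·)‖ ≤ C(N, M, a, rin, γ)` at every point of an open set on
  which all painted radii are `≥ rinⱼ`, for Lorentz factors `≤ γ`.

No definitions, no named facts, no `sorry`.
-/

set_option linter.dupNamespace false
set_option maxSynthPendingDepth 6
set_option synthInstance.maxHeartbeats 400000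

noncomputable section

namespace Summit.FinalStateConjecture.FinalStateConjecture.Theorems.SublinearIsFree.Slaving

open scoped BigOperators Topology ContDiff
open Filter Set Function Metric Literature.Geometry.Lorentzian
open Summit.FinalStateConjecture.FinalStateConjecture.Theorems

/-! ### Chain rule through a fixed frame operator and an affine map -/

section Affine

variable {F₁ F₂ : Type*} [NormedAddCommGroup F₁] [NormedSpace ℝ F₁] [NormedAddCommGroup F₂]
  [NormedSpace ℝ F₂]

/-- Chain rule for `z ↦ Φ (K (A (z − c)))`: derivative `Φ ∘ DK(A(y − c)) ∘ A`. [folklore] -/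
theorem momCap_hasFDerivAt_comp_affine (Φ : F₁ →L[ℝ] F₂) {K : E4 → F₁} {K' : E4 →L[ℝ] F₁}
    (A : E4 →L[ℝ] E4) (c : E4) {y : E4} (hK : HasFDerivAt K K' (A (y - c))) :
    HasFDerivAt (fun z ↦ Φ (K (A (z - c)))) (Φ.comp (K'.comp A)) y := by
  have hP : HasFDerivAt (fun z : E4 ↦ A (z - c)) A y := by
    have h := A.hasFDerivAt.comp y ((hasFDerivAt_id y).sub_const c)
    rwa [ContinuousLinearMap.comp_id] at h
  exact Φ.hasFDerivAt.comp y (hK.comp y hP)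

/-- `‖Φ ∘ T ∘ A‖ ≤ ‖Φ‖ ‖T‖ ‖A‖`. [folklore] -/
theorem momCap_norm_comp_comp_le (Φ : F₁ →L[ℝ] F₂) (T : E4 →L[ℝ] F₁) (A : E4 →L[ℝ] E4) :
    ‖Φ.comp (T.comp A)‖ ≤ ‖Φ‖ * ‖T‖ * ‖A‖ :=
  (ContinuousLinearMap.opNorm_comp_le _ _).trans (by
    rw [mul_assoc]
    exact mul_le_mul_of_nonneg_left (ContinuousLinearMap.opNorm_comp_le _ _) (norm_nonneg _))

/-- **Jets of `z ↦ Φ(K(A(z − c)))` up to order two.** If `K` is `C^∞` on an open set `s` containing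
`A(y − c)`, the composite is `C^∞` at `y` with `‖D(·)(y)‖ ≤ ‖Φ‖ ‖DK(A(y − c))‖ ‖A‖` and
`‖D²(·)(y)‖ ≤ ‖Φ‖ ‖D²K(A(y − c))‖ ‖A‖²` (chain rule twice; the first derivative is
`z ↦ Ξ(DK(A(z − c)))` with the fixed operator `Ξ T = Φ ∘ T ∘ A`). [folklore] -/
theorem momCap_jets_comp_affine [CompleteSpace F₁] (Φ : F₁ →L[ℝ] F₂) {K : E4 → F₁} {s : Set E4}
    (hs : IsOpen s) (hK : ContDiffOn ℝ ∞ K s) (A : E4 →L[ℝ] E4) (c : E4) {y : E4}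
    (hy : A (y - c) ∈ s) :
    ContDiffAt ℝ ∞ (fun z ↦ Φ (K (A (z - c)))) y ∧
      ‖fderiv ℝ (fun z ↦ Φ (K (A (z - c)))) y‖ ≤ ‖Φ‖ * ‖fderiv ℝ K (A (y - c))‖ * ‖A‖ ∧
      ‖fderiv ℝ (fderiv ℝ (fun z ↦ Φ (K (A (z - c))))) y‖ ≤
        ‖Φ‖ * ‖fderiv ℝ (fderiv ℝ K) (A (y - c))‖ * ‖A‖ ^ 2 := by
  have hPc : ContDiff ℝ ∞ (fun z : E4 ↦ A (z - c)) := A.contDiff.comp (contDiff_id.sub contDiff_const)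
  have hdK : ∀ z : E4, A (z - c) ∈ s → DifferentiableAt ℝ K (A (z - c)) := fun z hz ↦
    (hK.contDiffAt (hs.mem_nhds hz)).differentiableAt (by simp)
  have hd : ∀ z : E4, A (z - c) ∈ s →
      HasFDerivAt (fun z ↦ Φ (K (A (z - c)))) (Φ.comp ((fderiv ℝ K (A (z - c))).comp A)) z :=
    fun z hz ↦ momCap_hasFDerivAt_comp_affine Φ A c (hdK z hz).hasFDerivAt
  refine ⟨?_, ?_, ?_⟩
  · exact Φ.contDiff.contDiffAt.comp y ((hK.contDiffAt (hs.mem_nhds hy)).comp y hPc.contDiffAt)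
  · rw [(hd y hy).fderiv]
    exact momCap_norm_comp_comp_le Φ _ A
  · -- the first derivative near `y` through the fixed operator `Ξ T = Φ ∘ T ∘ A`
    set Ξ : (E4 →L[ℝ] F₁) →L[ℝ] (E4 →L[ℝ] F₂) :=
      (ContinuousLinearMap.postcomp E4 Φ).comp (ContinuousLinearMap.precomp F₁ A) with hΞ
    have hΞapply : ∀ T : E4 →L[ℝ] F₁, Ξ T = Φ.comp (T.comp A) := fun T ↦ by
      simp [hΞ]
    have hU : IsOpen ((fun z : E4 ↦ A (z - c)) ⁻¹' s) := hs.preimage hPc.continuous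
    have heq : fderiv ℝ (fun z ↦ Φ (K (A (z - c)))) =ᶠ[𝓝 y] fun z ↦ Ξ (fderiv ℝ K (A (z - c))) := by
      filter_upwards [hU.mem_nhds hy] with z hz
      rw [(hd z hz).fderiv, hΞapply]
    rw [heq.fderiv_eq]
    have hK₁ : ContDiffOn ℝ ∞ (fderiv ℝ K) s := hK.fderiv_of_isOpen hs (by simp)
    have h2 := momCap_hasFDerivAt_comp_affine Ξ A c
      (((hK₁.contDiffAt (hs.mem_nhds hy)).differentiableAt (by simp)).hasFDerivAt)
    rw [h2.fderiv]
    refine ContinuousLinearMap.opNorm_le_bound _ (by positivity) fun v ↦ ?_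
    change ‖Φ.comp (((fderiv ℝ (fderiv ℝ K) (A (y - c))) (A v)).comp A)‖ ≤ _
    calc ‖Φ.comp (((fderiv ℝ (fderiv ℝ K) (A (y - c))) (A v)).comp A)‖
        ≤ ‖Φ‖ * ‖(fderiv ℝ (fderiv ℝ K) (A (y - c))) (A v)‖ * ‖A‖ := momCap_norm_comp_comp_le Φ _ A
      _ ≤ ‖Φ‖ * (‖fderiv ℝ (fderiv ℝ K) (A (y - c))‖ * (‖A‖ * ‖v‖)) * ‖A‖ := by
          gcongr
          exact ((fderiv ℝ (fderiv ℝ K) (A (y - c))).le_opNorm _).trans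
            (mul_le_mul_of_nonneg_left (A.le_opNorm v) (norm_nonneg _))
      _ = ‖Φ‖ * ‖fderiv ℝ (fderiv ℝ K) (A (y - c))‖ * ‖A‖ ^ 2 * ‖v‖ := by ring

end Affine

/-! ### One frozen summand -/

-- the algebraic and the operator-norm instance paths on `E4 →L[ℝ] E4 →L[ℝ] ℝ` unify slowly
set_option maxHeartbeats 1600000 in
/-- **Jet-free `C²` bounds for one frozen boosted Kerr–Schild summand.** For `r₀ > 0` there is
`C = C(M, a, r₀) ≥ 0` such that for every Lorentz label `Λ`, centre event `c` and point `y` with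
`r(Λ⁻¹(y − c)) ≥ r₀`: `boostedKerrBilin Λ c M a` is `C^∞` at `y`, `‖D(·)(y)‖ ≤ C‖Λ⁻¹‖³` and
`‖D²(·)(y)‖ ≤ C‖Λ⁻¹‖⁴` (the summand is `Φ(g_{M,a}(Λ⁻¹(y − c)))` with the frame operator
`Φ T = T(Λ⁻¹·, Λ⁻¹·)`, `‖Φ‖ ≤ ‖Λ⁻¹‖²`; uniform `C²` bounds of `g_{M,a}` on `{r ≥ r₀}`,
`exists_bound_iteratedFDeriv_kerr`). [folklore] -/
theorem momCap_frozen_summand_bounds (M a : ℝ) {r₀ : ℝ} (hr₀ : 0 < r₀) :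
    ∃ C : ℝ, 0 ≤ C ∧ ∀ (Λ : lorentzGroup) (c y : E4), r₀ ≤ Kerr.radius a (poincareInv Λ c y) →
      ContDiffAt ℝ ∞ (boostedKerrBilin Λ c M a) y ∧
      ‖fderiv ℝ (boostedKerrBilin Λ c M a) y‖ ≤ C * ‖(((Λ : E4 ≃L[ℝ] E4).symm : E4 →L[ℝ] E4))‖ ^ 3 ∧
      ‖fderiv ℝ (fderiv ℝ (boostedKerrBilin Λ c M a)) y‖ ≤
        C * ‖(((Λ : E4 ≃L[ℝ] E4).symm : E4 →L[ℝ] E4))‖ ^ 4 := by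
  obtain ⟨C, hC0, hC⟩ := SublinearIsFree.Rechart.exists_bound_iteratedFDeriv_kerr M a hr₀
  refine ⟨C, hC0, fun Λ c y hy ↦ ?_⟩
  -- the smooth locus of `g_{M,a}`
  set s : Set E4 := {z : E4 | 0 < Kerr.radius a z} with hs
  have hso : IsOpen s := isOpen_lt continuous_const (Kerr.continuous_radius a)
  have hKs : ContDiffOn ℝ ∞ (Kerr.bilin M a) s := fun z hz ↦ (Kerr.contDiffAt_bilin M a hz).contDiffWithinAt
  set A : E4 →L[ℝ] E4 := (((Λ : E4 ≃L[ℝ] E4).symm : E4 →L[ℝ] E4)) with hA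
  have hpi : ∀ z : E4, poincareInv Λ c z = A (z - c) := fun z ↦ rfl
  have hy' : A (y - c) ∈ s := by
    rw [← hpi]; exact hr₀.trans_le hy
  -- the frame operator
  set Φ : (E4 →L[ℝ] E4 →L[ℝ] ℝ) →L[ℝ] (E4 →L[ℝ] E4 →L[ℝ] ℝ) :=
    (ContinuousLinearMap.postcomp E4 (ContinuousLinearMap.precomp ℝ A)).comp
      (ContinuousLinearMap.precomp (E4 →L[ℝ] ℝ) A) with hΦ
  have hΦapply : ∀ (T : E4 →L[ℝ] E4 →L[ℝ] ℝ) (v w : E4), Φ T v w = T (A v) (A w) := by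
    intro T v w
    simp [hΦ]
  have hΦnorm : ‖Φ‖ ≤ ‖A‖ ^ 2 := by
    refine ContinuousLinearMap.opNorm_le_bound _ (by positivity) fun T ↦ ?_
    refine ContinuousLinearMap.opNorm_le_bound₂ _ (by positivity) fun v w ↦ ?_
    rw [hΦapply]
    calc ‖T (A v) (A w)‖ ≤ ‖T‖ * ‖A v‖ * ‖A w‖ := T.le_opNorm₂ (A v) (A w)
      _ ≤ ‖T‖ * (‖A‖ * ‖v‖) * (‖A‖ * ‖w‖) := by
          gcongr
          · exact A.le_opNorm v
          · exact A.le_opNorm w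
      _ = ‖A‖ ^ 2 * ‖T‖ * ‖v‖ * ‖w‖ := by ring
  have hfun : boostedKerrBilin Λ c M a = fun z ↦ Φ (Kerr.bilin M a (A (z - c))) := by
    funext z
    refine ContinuousLinearMap.ext fun v ↦ ContinuousLinearMap.ext fun w ↦ ?_
    rw [hΦapply, boostedKerrBilin_apply, hpi]
    rfl
  obtain ⟨hcd, h1, h2⟩ := momCap_jets_comp_affine Φ hso hKs A c hy'
  have hb1 : ‖fderiv ℝ (Kerr.bilin M a) (A (y - c))‖ ≤ C := by
    rw [(norm_fderiv_eq_norm_iteratedFDeriv (Kerr.bilin M a) (A (y - c))).1, ← hpi]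
    exact hC _ hy 1 (by norm_num)
  have hb2 : ‖fderiv ℝ (fderiv ℝ (Kerr.bilin M a)) (A (y - c))‖ ≤ C := by
    rw [(norm_fderiv_eq_norm_iteratedFDeriv (Kerr.bilin M a) (A (y - c))).2, ← hpi]
    exact hC _ hy 2 le_rfl
  rw [hfun]
  refine ⟨hcd, h1.trans ?_, h2.trans ?_⟩
  · calc ‖Φ‖ * ‖fderiv ℝ (Kerr.bilin M a) (A (y - c))‖ * ‖A‖ ≤ ‖A‖ ^ 2 * C * ‖A‖ := by
          gcongr
      _ = C * ‖A‖ ^ 3 := by ring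
  · calc ‖Φ‖ * ‖fderiv ℝ (fderiv ℝ (Kerr.bilin M a)) (A (y - c))‖ * ‖A‖ ^ 2 ≤
        ‖A‖ ^ 2 * C * ‖A‖ ^ 2 := by gcongr
      _ = C * ‖A‖ ^ 4 := by ring

/-! ### Spatial derivatives see only the slice -/

/-- **Spatial derivatives of functions agreeing on a time slice near the point.** If `f` and `g`
are differentiable at `y` and agree at the points `z` near `y` with `z⁰ = y⁰`, then
`Df(y) w = Dg(y) w` for every spatial direction `w` (`w⁰ = 0`): both are the derivative at `0` of
`s ↦ f(y + s w)`, which agrees with `s ↦ g(y + s w)` for small `s`. [folklore] -/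
theorem momCap_fderiv_apply_eq_of_slice {F : Type*} [NormedAddCommGroup F] [NormedSpace ℝ F]
    {f g : E4 → F} {y : E4} (hf : DifferentiableAt ℝ f y) (hg : DifferentiableAt ℝ g y)
    (h : ∀ᶠ z in 𝓝 y, z 0 = y 0 → f z = g z) {w : E4} (hw : w 0 = 0) :
    fderiv ℝ f y w = fderiv ℝ g y w := by
  have hline : ∀ s : ℝ, (y + s • w) 0 = y 0 := fun s ↦ by simp [hw]
  have hγ : HasDerivAt (fun s : ℝ ↦ y + s • w) w 0 := by
    have h1 : HasDerivAt (fun s : ℝ ↦ s • w) ((1 : ℝ) • w) 0 := (hasDerivAt_id (0 : ℝ)).smul_const w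
    rw [one_smul] at h1
    exact h1.const_add y
  have hf' : HasDerivAt (fun s : ℝ ↦ f (y + s • w)) (fderiv ℝ f y w) 0 :=
    hf.hasFDerivAt.comp_hasDerivAt_of_eq 0 hγ (by simp)
  have hg' : HasDerivAt (fun s : ℝ ↦ g (y + s • w)) (fderiv ℝ g y w) 0 :=
    hg.hasFDerivAt.comp_hasDerivAt_of_eq 0 hγ (by simp)
  have hcont : Tendsto (fun s : ℝ ↦ y + s • w) (𝓝 0) (𝓝 y) := by
    have := hγ.continuousAt.tendsto
    simpa using this
  have heq : (fun s : ℝ ↦ f (y + s • w)) =ᶠ[𝓝 0] fun s ↦ g (y + s • w) := by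
    filter_upwards [hcont.eventually h] with s hs
    exact hs (hline s)
  exact (hf'.congr_of_eventuallyEq heq.symm).unique hg' |>.symm ▸ rfl

/-! ### The frozen multi-centre field -/

set_option maxHeartbeats 1600000 in
/-- **Jet-free `C²` bounds for the frozen multi-centre field** `η + Σⱼ (boostedKerrBilin Lⱼ cⱼ Mⱼ aⱼ − η)`
with constant labels: for floors `rinⱼ > 0` and `γ` there is `C = C(N, M, a, rin, γ) ≥ 0` such that
at every point all of whose rest-frame radii are `≥ rinⱼ`, for labels with `|Lⱼe₀⁰| ≤ γ`, the field
is `C^∞` with `‖D(·)‖, ‖D²(·)‖ ≤ C` (sum of `momCap_frozen_summand_bounds`, `‖Λ⁻¹‖ ≤ 1 + 3γ`).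
[folklore] -/
theorem momCap_frozen_field_bounds {N : ℕ} (M a rin : Fin N → ℝ) (hrin : ∀ j, 0 < rin j) (γ : ℝ) :
    ∃ C : ℝ, 0 ≤ C ∧ ∀ (L : Fin N → lorentzGroup) (c : Fin N → E4) (y : E4),
      (∀ j, |((L j : E4 ≃L[ℝ] E4) (E4.basisVector 0)) 0| ≤ γ) →
      (∀ j, rin j ≤ Kerr.radius (a j) (poincareInv (L j) (c j) y)) →
      ContDiffAt ℝ ∞ (fun z : E4 ↦ Minkowski.bilin +
          ∑ j, (boostedKerrBilin (L j) (c j) (M j) (a j) z - Minkowski.bilin)) y ∧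
        ‖fderiv ℝ (fun z : E4 ↦ Minkowski.bilin +
          ∑ j, (boostedKerrBilin (L j) (c j) (M j) (a j) z - Minkowski.bilin)) y‖ ≤ C ∧
        ‖fderiv ℝ (fderiv ℝ (fun z : E4 ↦ Minkowski.bilin +
          ∑ j, (boostedKerrBilin (L j) (c j) (M j) (a j) z - Minkowski.bilin))) y‖ ≤ C := by
  choose C hC0 hC using fun j ↦ momCap_frozen_summand_bounds (M j) (a j) (hrin j)
  refine ⟨∑ j, C j * (1 + 3 * |γ|) ^ 4, Finset.sum_nonneg fun j _ ↦ mul_nonneg (hC0 j) (by positivity),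
    fun L c y hγ hrad ↦ ?_⟩
  have h1le : (1 : ℝ) ≤ 1 + 3 * |γ| := by linarith [abs_nonneg γ]
  have hAn : ∀ j, ‖(((L j : E4 ≃L[ℝ] E4).symm : E4 →L[ℝ] E4))‖ ≤ 1 + 3 * |γ| := fun j ↦
    (norm_lorentz_symm_le' (L j)).trans (by linarith [hγ j, le_abs_self γ])
  have hpow3 : ∀ j, ‖(((L j : E4 ≃L[ℝ] E4).symm : E4 →L[ℝ] E4))‖ ^ 3 ≤ (1 + 3 * |γ|) ^ 4 := fun j ↦
    (pow_le_pow_left₀ (norm_nonneg _) (hAn j) 3).trans (pow_le_pow_right₀ h1le (by norm_num))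
  have hpow4 : ∀ j, ‖(((L j : E4 ≃L[ℝ] E4).symm : E4 →L[ℝ] E4))‖ ^ 4 ≤ (1 + 3 * |γ|) ^ 4 := fun j ↦
    pow_le_pow_left₀ (norm_nonneg _) (hAn j) 4
  -- the summands at `y`
  have hy : ∀ j, ContDiffAt ℝ ∞ (boostedKerrBilin (L j) (c j) (M j) (a j)) y ∧
      ‖fderiv ℝ (boostedKerrBilin (L j) (c j) (M j) (a j)) y‖ ≤
        C j * ‖(((L j : E4 ≃L[ℝ] E4).symm : E4 →L[ℝ] E4))‖ ^ 3 ∧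
      ‖fderiv ℝ (fderiv ℝ (boostedKerrBilin (L j) (c j) (M j) (a j))) y‖ ≤
        C j * ‖(((L j : E4 ≃L[ℝ] E4).symm : E4 →L[ℝ] E4))‖ ^ 4 := fun j ↦ hC j (L j) (c j) y (hrad j)
  -- the summands are smooth on the open set where all rest-frame radii are positive
  have hUo : IsOpen {z : E4 | ∀ j, 0 < Kerr.radius (a j) (poincareInv (L j) (c j) z)} := by
    rw [Set.setOf_forall]
    exact isOpen_iInter_of_finite fun j ↦ isOpen_lt continuous_const
      ((Kerr.continuous_radius _).comp (continuous_poincareInv _ _))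
  have hyU : y ∈ {z : E4 | ∀ j, 0 < Kerr.radius (a j) (poincareInv (L j) (c j) z)} :=
    fun j ↦ (hrin j).trans_le (hrad j)
  have hFd : ∀ j, ∀ z ∈ {z : E4 | ∀ j, 0 < Kerr.radius (a j) (poincareInv (L j) (c j) z)},
      ContDiffAt ℝ ∞ (boostedKerrBilin (L j) (c j) (M j) (a j)) z := fun j z hz ↦ by
    obtain ⟨C', -, hC'⟩ := momCap_frozen_summand_bounds (M j) (a j) (half_pos (hz j))
    exact (hC' (L j) (c j) z (by linarith [hz j])).1
  -- the derivative of the sum on that open set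
  have hKd : ∀ z ∈ {z : E4 | ∀ j, 0 < Kerr.radius (a j) (poincareInv (L j) (c j) z)},
      HasFDerivAt (fun z : E4 ↦ Minkowski.bilin +
        ∑ j, (boostedKerrBilin (L j) (c j) (M j) (a j) z - Minkowski.bilin))
        (∑ j, fderiv ℝ (boostedKerrBilin (L j) (c j) (M j) (a j)) z) z := fun z hz ↦ by
    have h := HasFDerivAt.fun_sum (u := Finset.univ)
      (A := fun j z ↦ boostedKerrBilin (L j) (c j) (M j) (a j) z - Minkowski.bilin)
      (fun j _ ↦ (((hFd j z hz).differentiableAt (by simp)).hasFDerivAt.sub_const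
        (Minkowski.bilin : E4 →L[ℝ] E4 →L[ℝ] ℝ)))
    exact h.const_add _
  refine ⟨contDiffAt_const.add (ContDiffAt.sum fun j _ ↦ (hFd j y hyU).sub contDiffAt_const), ?_, ?_⟩
  · rw [(hKd y hyU).fderiv]
    refine (norm_sum_le _ _).trans (Finset.sum_le_sum fun j _ ↦ (hy j).2.1.trans ?_)
    exact mul_le_mul_of_nonneg_left (hpow3 j) (hC0 j)
  · have heq : fderiv ℝ (fun z : E4 ↦ Minkowski.bilin +
        ∑ j, (boostedKerrBilin (L j) (c j) (M j) (a j) z - Minkowski.bilin)) =ᶠ[𝓝 y]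
        fun z ↦ ∑ j, fderiv ℝ (boostedKerrBilin (L j) (c j) (M j) (a j)) z := by
      filter_upwards [hUo.mem_nhds hyU] with z hz using (hKd z hz).fderiv
    rw [heq.fderiv_eq]
    have h2 : HasFDerivAt (fun z ↦ ∑ j, fderiv ℝ (boostedKerrBilin (L j) (c j) (M j) (a j)) z)
        (∑ j, fderiv ℝ (fderiv ℝ (boostedKerrBilin (L j) (c j) (M j) (a j))) y) y :=
      HasFDerivAt.fun_sum fun j _ ↦
        (((hy j).1.fderiv_right (m := ∞) (by simp)).differentiableAt
          (by simp)).hasFDerivAt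
    rw [h2.fderiv]
    refine (norm_sum_le _ _).trans (Finset.sum_le_sum fun j _ ↦ (hy j).2.2.trans ?_)
    exact mul_le_mul_of_nonneg_left (hpow4 j) (hC0 j)

/-! ### The slice data of the modulated ansatz -/

open Literature.Geometry.Lorentzian.MetricCoord in
set_option maxHeartbeats 1600000 in
/-- **Jet-free bounds for the slice data of the modulated ansatz.** For floors `rinⱼ > 0` and `γ`
there is `C = C(N, M, a, rin, γ) ≥ 0` such that for every smooth painted motion with Lorentz factors
`≤ γ`, at every point `x` of an open set `U` on which all painted radii are `≥ rinⱼ`, the spatial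
first derivatives and the spatial–spatial second derivatives of
`g₀ = η + Σⱼ (boostedKerrBilin (Λⱼ(z⁰)) (z⁰, ξⱼ(z⁰)) Mⱼ aⱼ z − η)` satisfy `‖Dg₀(x)w‖ ≤ C‖w‖`,
`‖D²g₀(x)(w)(w')‖ ≤ C‖w‖‖w'‖` (`w⁰ = w'⁰ = 0`): on the slice `{z⁰ = x⁰}` the ansatz IS the field
frozen at `x⁰`, so its spatial derivatives of orders one and two at `x` are those of the frozen
field (`momCap_fderiv_apply_eq_of_slice`, twice), bounded by `momCap_frozen_field_bounds`.
[folklore] -/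
theorem momCap_sliceData_bound {N : ℕ} (M a rin : Fin N → ℝ) (hrin : ∀ j, 0 < rin j) (γ : ℝ) :
    ∃ C : ℝ, 0 ≤ C ∧ ∀ (Λ : Fin N → ℝ → lorentzGroup) (ξ : Fin N → ℝ → E3),
      (∀ i t, |((Λ i t : E4 ≃L[ℝ] E4) (E4.basisVector 0)) 0| ≤ γ) →
      (∀ i, ContDiff ℝ ((⊤ : ℕ∞) : WithTop ℕ∞) (ξ i) ∧
        ContDiff ℝ ((⊤ : ℕ∞) : WithTop ℕ∞) (fun t ↦ ((Λ i t : E4 ≃L[ℝ] E4) : E4 →L[ℝ] E4))) →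
      ∀ {U : Set E4} {x : E4}, IsOpen U → x ∈ U →
      (∀ z ∈ U, ∀ j, rin j ≤
        Kerr.radius (a j) (poincareInv (Λ j (z 0)) (E4.ofTimeSpace (z 0) (ξ j (z 0))) z)) →
      (∀ w : E4, w 0 = 0 → ‖fderiv ℝ (fun z : E4 ↦ Minkowski.bilin + ∑ i, (boostedKerrBilin
          (Λ i (z 0)) (E4.ofTimeSpace (z 0) (ξ i (z 0))) (M i) (a i) z - Minkowski.bilin)) x w‖ ≤
          C * ‖w‖) ∧
      (∀ w w' : E4, w 0 = 0 → w' 0 = 0 → ‖fderiv ℝ (fderiv ℝ (fun z : E4 ↦ Minkowski.bilin +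
          ∑ i, (boostedKerrBilin (Λ i (z 0)) (E4.ofTimeSpace (z 0) (ξ i (z 0))) (M i) (a i) z -
            Minkowski.bilin))) x w w'‖ ≤ C * ‖w‖ * ‖w'‖) := by
  obtain ⟨C, hC0, hC⟩ := momCap_frozen_field_bounds M a rin hrin γ
  refine ⟨C, hC0, fun Λ ξ hγ hsm U x hU hx hrad ↦ ?_⟩
  set g₀ : E4 → E4 →L[ℝ] E4 →L[ℝ] ℝ := fun z : E4 ↦ Minkowski.bilin + ∑ i, (boostedKerrBilin
    (Λ i (z 0)) (E4.ofTimeSpace (z 0) (ξ i (z 0))) (M i) (a i) z - Minkowski.bilin) with hg₀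
  -- the field frozen at the lab time `x⁰`
  set K : E4 → E4 →L[ℝ] E4 →L[ℝ] ℝ := fun z : E4 ↦ Minkowski.bilin + ∑ i, (boostedKerrBilin
    (Λ i (x 0)) (E4.ofTimeSpace (x 0) (ξ i (x 0))) (M i) (a i) z - Minkowski.bilin) with hK
  have hagree : ∀ z : E4, z 0 = x 0 → g₀ z = K z := fun z hz ↦ by
    simp only [hg₀, hK, hz]
  have hg₀d : ∀ z ∈ U, ContDiffAt ℝ ∞ g₀ z := fun z hz ↦
    contDiffAt_ansatzBilin' N M a Λ ξ (fun j ↦ (hsm j).2) (fun j ↦ (hsm j).1) z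
      (fun j ↦ (hrin j).trans_le (hrad z hz j))
  have hKf : ∀ z ∈ U, z 0 = x 0 →
      ContDiffAt ℝ ∞ K z ∧ ‖fderiv ℝ K z‖ ≤ C ∧ ‖fderiv ℝ (fderiv ℝ K) z‖ ≤ C := fun z hz hz0 ↦
    hC (fun j ↦ Λ j (x 0)) (fun j ↦ E4.ofTimeSpace (x 0) (ξ j (x 0))) z (fun j ↦ hγ j (x 0))
      (fun j ↦ by have h := hrad z hz j; rwa [hz0] at h)
  -- first order, at every slice point of `U`
  have hD1 : ∀ z ∈ U, z 0 = x 0 → ∀ w : E4, w 0 = 0 → fderiv ℝ g₀ z w = fderiv ℝ K z w :=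
    fun z hz hz0 w hw ↦ momCap_fderiv_apply_eq_of_slice ((hg₀d z hz).differentiableAt (by simp))
      ((hKf z hz hz0).1.differentiableAt (by simp))
      (Eventually.of_forall fun z' hz' ↦ hagree z' (hz'.trans hz0)) hw
  -- second order, at `x`
  have hD2 : ∀ w w' : E4, w 0 = 0 → w' 0 = 0 →
      fderiv ℝ (fderiv ℝ g₀) x w w' = fderiv ℝ (fderiv ℝ K) x w w' := by
    intro w w' hw hw'
    have hg₀' : DifferentiableAt ℝ (fderiv ℝ g₀) x :=
      ((hg₀d x hx).fderiv_right (m := ∞) (by simp)).differentiableAt (by simp)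
    have hK' : DifferentiableAt ℝ (fderiv ℝ K) x :=
      ((hKf x hx rfl).1.fderiv_right (m := ∞) (by simp)).differentiableAt (by simp)
    rw [← fderiv_clm_apply_const hg₀' w' w, ← fderiv_clm_apply_const hK' w' w]
    refine momCap_fderiv_apply_eq_of_slice (differentiableAt_clm_apply_const hg₀' w')
      (differentiableAt_clm_apply_const hK' w') ?_ hw
    filter_upwards [hU.mem_nhds hx] with z hz hz0
    exact hD1 z hz hz0 w' hw'
  obtain ⟨-, hb1, hb2⟩ := hKf x hx rfl
  refine ⟨fun w hw ↦ ?_, fun w w' hw hw' ↦ ?_⟩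
  · rw [hD1 x hx rfl w hw]
    exact ((fderiv ℝ K x).le_opNorm w).trans (mul_le_mul_of_nonneg_right hb1 (norm_nonneg _))
  · rw [hD2 w w' hw hw']
    exact ((fderiv ℝ (fderiv ℝ K) x).le_opNorm₂ w w').trans (by gcongr)

/-- **Registered one-line carrier form** (`momCap_fderiv_apply_eq_of_slice_sA`) of
`momCap_fderiv_apply_eq_of_slice`: spatial derivatives of two functions agreeing on the time slice
near the point coincide. [folklore] -/
theorem momCap_fderiv_apply_eq_of_slice_sA : ∀ {F : Type} [NormedAddCommGroup F] [NormedSpace ℝ F] {f g : E4 → F} {y : E4}, DifferentiableAt ℝ f y → DifferentiableAt ℝ g y → (∀ᶠ z in nhds y, z 0 = y 0 → f z = g z) → ∀ {w : E4}, w 0 = 0 → fderiv ℝ f y w = fderiv ℝ g y w :=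
  fun hf hg h _ hw ↦ momCap_fderiv_apply_eq_of_slice hf hg h hw

end Summit.FinalStateConjecture.FinalStateConjecture.Theorems.SublinearIsFree.Slaving

end
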